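import Literature.AlgebraicGeometry.Resolution.SmoothDescentFlat
import Literature.AlgebraicGeometry.Morphisms.FlatOfComp
import Mathlib.AlgebraicGeometry.Morphisms.Smooth
import Mathlib.RingTheory.Smooth.Fiber
import HarnessLib

/-!
# Smoothness descends along a flat surjective morphism of the source — any base (EGA IV₄ 17.7.7)

Layer `Literature/AlgebraicGeometry/Morphisms` (cell hodgecm-mathlib; count-neutral PROOF-lane capital).

EGA IV₄ Prop. 17.7.7 (p. 74: «Soient `f : Y → S` et `h : X → S` deux morphismes localement de présentation
finie, `g : X → Y` un `S`-morphisme, `x` un point de `X`, `y = g(x)`. Supposons que `g` soit plat au point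
`x`. Alors, si `h` est lisse au point `x`, `f` est lisse au point `y`.») in its global form = The Stacks
Project, Tag 05B5: for `ψ : A → Q` flat and surjective and `g : Q → S` locally of finite presentation,
`ψ ≫ g` smooth implies `g` smooth.  The sister file
`SmoothOfFlatSurjectiveSmoothSource.lean` proves this over a locally Noetherian base `S` WITH PERFECT
RESIDUE FIELDS (through regularity of the fibres).  Here the two extra hypotheses are removed, following
the printed proof of Tag 05B5: `g` is flat by two-out-of-three (Tag 02JZ, ★
`Morphisms.Flat.of_comp_of_surjective`); by the fibrewise criterion (Tags 00TF/01V8, Mathlib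
`Algebra.IsSmoothAt.of_formallySmooth_fiber`) it suffices that the fibre rings of `g` over the residue
fields `κ(𝔭)` of `S` are smooth over `κ(𝔭)`; and over a field smoothness descends, pointwise, along flat
morphisms (Tag 05AX, ★ `Resolution.isSmoothAt_comap_of_flat_of_field` — NO perfectness: geometric
regularity, not regularity, is what descends), every point of a fibre of `g` being the image of a point
of the corresponding fibre of the smooth `ψ ≫ g`.

* `isSmoothAt_fiber_of_flat_of_smooth` — the affine heart: `Λ → R → D` with `D` flat over `R` and smooth
  over `Λ`, `R` of finite type over `Λ`; a prime `P′` of the fibre ring `κ(𝔭) ⊗_Λ R` whose trace on `R`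
  lies under a prime of `D` is a `κ(𝔭)`-smooth point of `κ(𝔭) ⊗_Λ R`;
* **`smooth_of_smooth_comp_of_flat_surjective`** — `ψ` flat surjective, `g` locally of finite
  presentation, `ψ ≫ g` smooth ⟹ `g` smooth (any base `S`);
* `smooth_of_smooth_comp_of_flat_surjective'` — the same with the composite named (`ψ ≫ g = f`).

Consumer: ★ `AbelianSchemes/AbelianSchemeOfFlatSurjectiveImage.smooth_hom_of_flat_surjective` without its
`hperf` / `IsLocallyNoetherian` hypotheses (P6b census item (r5)).  Theorems only; no definitions, no
named facts.

## References

* [Grothendieck1967] A. Grothendieck, *EGA IV₄* (Publ. Math. IHÉS 32, 1967): Prop. 17.7.7 (p. 74; smoothness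
  at `g(x)` from smoothness of the composite at `x` and flatness of `g` at `x`), Prop. 17.5.1 (fibrewise
  criterion).
* [StacksProject] The Stacks Project, Tag 05B5 (and its proof), Tag 05AX, Tag 00TF, Tag 02JZ.
-/

noncomputable section

open CategoryTheory CategoryTheory.Limits AlgebraicGeometry TopologicalSpace TensorProduct

universe u

namespace Literature.AlgebraicGeometry.Morphisms

open Literature.AlgebraicGeometry.Resolution

/-! ### §1 The affine heart: a point of the fibre ring lying under a point of a flat smooth cover -/

/-- **A point of the fibre `κ(𝔭) ⊗_Λ R` lying under a point of a flat `R`-algebra smooth over `Λ` is a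
smooth point** (The Stacks Project, proof of Tag 05B5, steps (3)–(4), pointwise): `Λ → R → D` with `D`
flat over `R` and smooth over `Λ`, `R` of finite type over `Λ`, `𝔭` a prime of `Λ`; if the trace on `R`
of the prime `P′` of `κ(𝔭) ⊗_Λ R` is the trace of a prime `r` of `D`, then `κ(𝔭) ⊗_Λ R` is
`κ(𝔭)`-smooth at `P′`.  Indeed `κ(𝔭) ⊗_Λ R → κ(𝔭) ⊗_Λ D` is flat with `κ(𝔭)`-smooth target, the prime
of `κ(𝔭) ⊗_Λ D` over `r` lies over `P′` (a prime of a fibre ring is determined by its trace), and Tag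
05AX (★ `isSmoothAt_comap_of_flat_of_field`) applies. [cite: StacksProject, Tag 05B5 (proof) and Tag 05AX] -/
theorem isSmoothAt_fiber_of_flat_of_smooth (Λ R D : Type u) [CommRing Λ] [CommRing R] [CommRing D]
    [Algebra Λ R] [Algebra Λ D] [Algebra R D] [IsScalarTower Λ R D] [Algebra.FiniteType Λ R]
    [Module.Flat R D] [Algebra.Smooth Λ D] (p : Ideal Λ) [p.IsPrime]
    (P' : Ideal (p.Fiber R)) [P'.IsPrime] (r : Ideal D) [r.IsPrime]
    (hr : r.comap (algebraMap R D) =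
      P'.comap (Algebra.TensorProduct.includeRight (R := Λ) (A := p.ResidueField) :
        R →ₐ[Λ] p.Fiber R).toRingHom) :
    Algebra.IsSmoothAt p.ResidueField P' := by
  set κ := p.ResidueField
  -- the fibre map `κ ⊗ R → κ ⊗ D`
  let φ : R →ₐ[Λ] D := IsScalarTower.toAlgHom Λ R D
  let Ψ : κ ⊗[Λ] R →ₐ[κ] κ ⊗[Λ] D := Algebra.TensorProduct.map (AlgHom.id κ κ) φ
  letI : Algebra (κ ⊗[Λ] R) (κ ⊗[Λ] D) := Ψ.toRingHom.toAlgebra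
  haveI : IsScalarTower κ (κ ⊗[Λ] R) (κ ⊗[Λ] D) :=
    IsScalarTower.of_algebraMap_eq fun c => (Ψ.commutes c).symm
  have hΨ : ∀ a : R, algebraMap (κ ⊗[Λ] R) (κ ⊗[Λ] D) ((1 : κ) ⊗ₜ[Λ] a) =
      (1 : κ) ⊗ₜ[Λ] (algebraMap R D a) := fun a => by
    change Ψ ((1 : κ) ⊗ₜ[Λ] a) = _
    simp [Ψ, φ]
  -- it is flat (pasting of pushouts)
  haveI : Module.Flat (κ ⊗[Λ] R) (κ ⊗[Λ] D) := by
    letI : Algebra R (κ ⊗[Λ] R) := Algebra.TensorProduct.rightAlgebra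
    letI : Algebra D (κ ⊗[Λ] D) := Algebra.TensorProduct.rightAlgebra
    letI : Algebra R (κ ⊗[Λ] D) := ((algebraMap D (κ ⊗[Λ] D)).comp (algebraMap R D)).toAlgebra
    haveI : IsScalarTower R D (κ ⊗[Λ] D) := IsScalarTower.of_algebraMap_eq fun _ => rfl
    haveI : IsScalarTower R (κ ⊗[Λ] R) (κ ⊗[Λ] D) :=
      IsScalarTower.of_algebraMap_eq fun a => (hΨ a).symm
    haveI : IsScalarTower Λ D (κ ⊗[Λ] D) := IsScalarTower.of_algebraMap_eq fun c =>
      ((Algebra.TensorProduct.includeRight (R := Λ) (A := κ) : D →ₐ[Λ] κ ⊗[Λ] D).commutes c).symm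
    haveI : IsScalarTower Λ R (κ ⊗[Λ] R) := IsScalarTower.of_algebraMap_eq fun c =>
      ((Algebra.TensorProduct.includeRight (R := Λ) (A := κ) : R →ₐ[Λ] κ ⊗[Λ] R).commutes c).symm
    haveI : IsScalarTower Λ (κ ⊗[Λ] R) (κ ⊗[Λ] D) := IsScalarTower.of_algebraMap_eq fun c => by
      rw [IsScalarTower.algebraMap_apply Λ κ (κ ⊗[Λ] R),
        IsScalarTower.algebraMap_apply Λ κ (κ ⊗[Λ] D)]
      exact (Ψ.commutes _).symm
    have h1 : Algebra.IsPushout Λ D κ (κ ⊗[Λ] D) := inferInstance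
    have h2 : Algebra.IsPushout R D (κ ⊗[Λ] R) (κ ⊗[Λ] D) :=
      (Algebra.IsPushout.comp_iff (R := Λ) (S := R) (T := D) (R' := κ) (S' := κ ⊗[Λ] R)
        (T' := κ ⊗[Λ] D)).mp h1
    haveI := h2.symm
    exact Module.Flat.of_linearEquiv
      (Algebra.IsPushout.equiv R (κ ⊗[Λ] R) D (κ ⊗[Λ] D)).symm.toLinearEquiv
  -- its target is `κ`-smooth, source and target are of finite type over `κ`
  haveI : Algebra.Smooth κ (κ ⊗[Λ] D) := inferInstance
  haveI : Algebra.FiniteType κ (κ ⊗[Λ] R) := inferInstance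
  haveI : Algebra.FinitePresentation κ (κ ⊗[Λ] D) := Algebra.Smooth.finitePresentation
  haveI : Algebra.FiniteType κ (κ ⊗[Λ] D) := inferInstance
  -- `r` lies over `𝔭`
  have hrp : r.comap (algebraMap Λ D) = p := by
    rw [IsScalarTower.algebraMap_eq Λ R D, ← Ideal.comap_comap, hr, Ideal.comap_comap]
    have : (Algebra.TensorProduct.includeRight (R := Λ) (A := κ) : R →ₐ[Λ] κ ⊗[Λ] R).toRingHom.comp
        (algebraMap Λ R) = algebraMap Λ (κ ⊗[Λ] R) :=
      (Algebra.TensorProduct.includeRight (R := Λ) (A := κ) : R →ₐ[Λ] κ ⊗[Λ] R).comp_algebraMap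
    rw [this]
    exact (P'.over_def p).symm
  -- the prime `r′` of `κ ⊗ D` over `r`
  let rpt : PrimeSpectrum.comap (algebraMap Λ D) ⁻¹' {(⟨p, ‹_›⟩ : PrimeSpectrum Λ)} :=
    ⟨⟨r, ‹_›⟩, by simpa [PrimeSpectrum.ext_iff] using hrp⟩
  let r' : PrimeSpectrum (p.Fiber D) := PrimeSpectrum.preimageEquivFiber Λ D ⟨p, ‹_›⟩ rpt
  have hr'r : r'.asIdeal.comap
      (Algebra.TensorProduct.includeRight (R := Λ) (A := κ) : D →ₐ[Λ] κ ⊗[Λ] D).toRingHom = r := by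
    have h := (PrimeSpectrum.preimageEquivFiber Λ D ⟨p, ‹_›⟩).symm_apply_apply rpt
    exact congrArg (fun z => z.1.asIdeal) h
  -- every point of the smooth `κ ⊗ D` is a smooth point
  haveI : Algebra.IsSmoothAt κ r'.asIdeal := by
    have : r' ∈ Algebra.smoothLocus κ (κ ⊗[Λ] D) := by
      rw [Algebra.smoothLocus_eq_univ]; trivial
    exact this
  -- Tag 05AX at `r′`
  have key := isSmoothAt_comap_of_flat_of_field κ (κ ⊗[Λ] R) (κ ⊗[Λ] D) r'.asIdeal
  -- the trace of `r′` on `κ ⊗ R` is `P′`: both have trace `r ∩ R` on `R`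
  have hsq : (algebraMap (κ ⊗[Λ] R) (κ ⊗[Λ] D)).comp
      (Algebra.TensorProduct.includeRight (R := Λ) (A := κ) : R →ₐ[Λ] κ ⊗[Λ] R).toRingHom =
      (Algebra.TensorProduct.includeRight (R := Λ) (A := κ) : D →ₐ[Λ] κ ⊗[Λ] D).toRingHom.comp
        (algebraMap R D) := by
    ext a
    simpa using hΨ a
  have htrace : (r'.asIdeal.comap (algebraMap (κ ⊗[Λ] R) (κ ⊗[Λ] D))).comap
      (Algebra.TensorProduct.includeRight (R := Λ) (A := κ) : R →ₐ[Λ] κ ⊗[Λ] R).toRingHom =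
      P'.comap (Algebra.TensorProduct.includeRight (R := Λ) (A := κ) : R →ₐ[Λ] κ ⊗[Λ] R).toRingHom := by
    rw [Ideal.comap_comap, hsq, ← Ideal.comap_comap, hr'r, hr]
  have hcomap : r'.asIdeal.comap (algebraMap (κ ⊗[Λ] R) (κ ⊗[Λ] D)) = P' := by
    haveI : (r'.asIdeal.comap (algebraMap (κ ⊗[Λ] R) (κ ⊗[Λ] D))).IsPrime := Ideal.IsPrime.comap _
    let E := PrimeSpectrum.preimageEquivFiber Λ R ⟨p, ‹_›⟩
    have hinj := E.symm.injective
      (a₁ := ⟨r'.asIdeal.comap (algebraMap (κ ⊗[Λ] R) (κ ⊗[Λ] D)), this⟩) (a₂ := ⟨P', ‹_›⟩)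
      (Subtype.ext (PrimeSpectrum.ext htrace))
    exact congrArg PrimeSpectrum.asIdeal hinj
  subst hcomap
  exact key

/-! ### §2 EGA IV₄ 17.7.7 over any base -/

/-- **Smoothness descends along a flat surjective morphism of the source** (EGA IV₄ Prop. 17.7.7, global
form; The Stacks Project, Tag 05B5 with the first step — `g` locally of finite presentation — as a
hypothesis): for
`ψ : A → Q` flat and surjective and `g : Q → S` locally of finite presentation with `ψ ≫ g` smooth, `g`
is smooth.  No hypothesis on the base `S`.  Proof: `g` is flat (Tag 02JZ, ★ `Flat.of_comp_of_surjective`);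
at a point `q ∈ Q`, with affine opens `q ∈ V ⊆ g⁻¹ U`, smoothness of `g` at `q` follows from smoothness of
the whole fibre ring `κ(𝔭) ⊗_{Γ(S,U)} Γ(Q,V)` over `κ(𝔭)` (Tags 00TF/01V8, Mathlib
`Algebra.IsSmoothAt.of_formallySmooth_fiber`), and every prime of that fibre ring is the point of `V`
under a point `a` of `A`, i.e. under a prime of `Γ(A, W)` for an affine open `a ∈ W ⊆ ψ⁻¹ V`, which is
flat over `Γ(Q, V)` and smooth over `Γ(S, U)` — so `isSmoothAt_fiber_of_flat_of_smooth` applies.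
[cite: Grothendieck1967, Prop. 17.7.7 (p. 74)] [cite: StacksProject, Tag 05B5] -/
theorem smooth_of_smooth_comp_of_flat_surjective {A Q S : Scheme.{u}} (ψ : A ⟶ Q) (g : Q ⟶ S)
    [Flat ψ] [Surjective ψ] [LocallyOfFinitePresentation g] [Smooth (ψ ≫ g)] : Smooth g := by
  haveI : Flat g := Flat.of_comp_of_surjective ψ g
  rw [← Scheme.Hom.smoothLocus_eq_top_iff]
  refine top_le_iff.mp fun q _ => ?_
  -- affine opens `g q ∈ U ⊆ S`, `q ∈ V ⊆ g⁻¹ U`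
  obtain ⟨_, ⟨U, hU, rfl⟩, hqU, -⟩ :=
    S.isBasis_affineOpens.exists_subset_of_mem_open (Set.mem_univ (g q)) isOpen_univ
  obtain ⟨_, ⟨V, hV, rfl⟩, hqV, hVU⟩ :=
    Q.isBasis_affineOpens.exists_subset_of_mem_open hqU (U.2.preimage g.continuous)
  have hfp := g.finitePresentation_appLE hU hV hVU
  have hfl := g.flat_appLE hU hV hVU
  algebraize [(g.appLE U V hVU).hom]
  haveI : Module.Flat Γ(S, U) Γ(Q, V) := hfl
  rw [Scheme.Hom.mem_smoothLocus, formallySmooth_stalkMap_iff U hU V hV hVU hqV]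
  -- the fibrewise criterion: it suffices that the whole fibre ring over `𝔭 = g q` is smooth
  set P := (hV.primeIdealOf ⟨q, hqV⟩).asIdeal with hP
  let p : Ideal Γ(S, U) := P.under Γ(S, U)
  change Algebra.IsSmoothAt Γ(S, U) P
  suffices hfib : Algebra.FormallySmooth p.ResidueField (p.Fiber Γ(Q, V)) from
    Algebra.IsSmoothAt.of_formallySmooth_fiber p P
  haveI : Algebra.FinitePresentation p.ResidueField (p.Fiber Γ(Q, V)) := inferInstance
  refine Algebra.smoothLocus_eq_univ_iff.mp (Set.eq_univ_iff_forall.mpr fun P' => ?_)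
  change Algebra.IsSmoothAt p.ResidueField P'.asIdeal
  -- the point `q′ ∈ V` of the prime `P′ ∩ Γ(Q, V)`, a point `a` of `A` over it, an affine `a ∈ W ⊆ ψ⁻¹ V`
  let Pq : PrimeSpectrum Γ(Q, V) :=
    PrimeSpectrum.comap (Algebra.TensorProduct.includeRight (R := Γ(S, U)) (A := p.ResidueField) :
      Γ(Q, V) →ₐ[Γ(S, U)] p.Fiber Γ(Q, V)).toRingHom P'
  let q' : V := hV.isoSpec.inv Pq
  have hq' : hV.primeIdealOf q' = Pq := by
    change (hV.isoSpec.inv ≫ hV.isoSpec.hom) Pq = Pq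
    rw [Iso.inv_hom_id]
    rfl
  obtain ⟨a, ha⟩ := ψ.surjective (q' : Q)
  have haV : a ∈ ψ ⁻¹ᵁ V := by
    change ψ a ∈ V
    rw [ha]
    exact q'.2
  obtain ⟨_, ⟨W, hW, rfl⟩, haW, hWV⟩ :=
    A.isBasis_affineOpens.exists_subset_of_mem_open haV (V.2.preimage ψ.continuous)
  -- the rings `Γ(S,U) → Γ(Q,V) → Γ(A,W)`: the second map flat, the composite smooth
  have hflψ := ψ.flat_appLE hV hW hWV
  have hWU : W ≤ (ψ ≫ g) ⁻¹ᵁ U := by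
    rw [Scheme.Hom.comp_preimage]
    exact fun x hx => hVU (hWV hx)
  have hsm := (ψ ≫ g).smooth_appLE hU hW hWU
  rw [← Scheme.Hom.appLE_comp_appLE ψ g U V W hVU hWV] at hsm
  algebraize [(ψ.appLE V W hWV).hom, (g.appLE U V hVU ≫ ψ.appLE V W hWV).hom]
  haveI : IsScalarTower Γ(S, U) Γ(Q, V) Γ(A, W) := IsScalarTower.of_algebraMap_eq' rfl
  haveI : Module.Flat Γ(Q, V) Γ(A, W) := hflψ
  haveI : Algebra.Smooth Γ(S, U) Γ(A, W) := by
    rw [← RingHom.smooth_algebraMap]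
    exact hsm
  haveI : Algebra.FiniteType Γ(S, U) Γ(Q, V) := inferInstance
  -- the prime of `Γ(A, W)` at `a` lies over `P′ ∩ Γ(Q, V)`
  refine isSmoothAt_fiber_of_flat_of_smooth Γ(S, U) Γ(Q, V) Γ(A, W) p P'.asIdeal
    (hW.primeIdealOf ⟨a, haW⟩).asIdeal ?_
  have h := IsAffineOpen.comap_primeIdealOf_appLE V hV W hW hWV haW (f := ψ)
  have h' : hV.primeIdealOf ⟨ψ a, hWV haW⟩ = hV.primeIdealOf q' := by
    congr 1
    exact Subtype.ext ha
  rw [h', hq'] at h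
  exact congrArg PrimeSpectrum.asIdeal h

/-- **EGA IV₄ 17.7.7, named-composite form**: `ψ : A → Q` flat surjective, `f = ψ ≫ g` smooth,
`g : Q → S` locally of finite presentation ⟹ `g` smooth (any base `S`; cf. the sister
`smooth_of_flat_surjective_of_smooth_comp`, which assumes `S` locally Noetherian with perfect residue
fields). [cite: Grothendieck1967, Prop. 17.7.7 (p. 74)] [cite: StacksProject, Tag 05B5] -/
theorem smooth_of_smooth_comp_of_flat_surjective' {A Q S : Scheme.{u}} (ψ : A ⟶ Q) (g : Q ⟶ S)
    (f : A ⟶ S) (hf : ψ ≫ g = f) [Flat ψ] [Surjective ψ] [Smooth f] [LocallyOfFinitePresentation g] :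
    Smooth g := by
  subst hf
  exact smooth_of_smooth_comp_of_flat_surjective ψ g

end Literature.AlgebraicGeometry.Morphisms

end
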